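import Literature.Barriers.CriticalPhenomena.PlaquetteWalkHoleRootDeadDoorBelow
import Literature.Barriers.CriticalPhenomena.PlaquetteWalkHoleRootNearCells
import HarnessLib

/-!
# Barrier catalogue (SAWScalingLimit): LAW L AT DISTANCE ONE, THE TIGHT SIDE — two rows behind a near cell its route is EMPTY

Leaf of `PlaquetteWalkHoleRootDeadDoorBelow` (dead door `holeS | rootS` + floor ⇒ no wound under-walk; dead door
`holeN | rootN` + ceiling ⇒ no wound over-walk; the one-route sign theorems with abstract witnesses) and of the landed
every-position witness blocks (`nearBlockSO2`, `nearBlockNU1` of `PlaquetteWalkHoleRootNearCells`; `ringBlockON1a`,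
`ringBlockUS2a` of `PlaquetteWalkHoleRootInteriorRing`; placement `block_hroot_subset_boxMinus_of_bounds`). Setting: the
`m × n` box `boxMinus m n S`, hole `h ∈ S`, root plaquette `(h.1 + 1, h.2)` rooted at `W`, far cell `(h.1 − 1, h.2) ∉ S`.

* ★★★★★ `lawL_box_tightS_not_wound_under` — ALL BOXES: hole two rows above the bottom wall (`h.2 = 2`) and `holeS = (h.1, 1)`
  or `rootS = (h.1 + 1, 1)` in `S` ⇒ NO wound under-walk (whatever else `S` removes); `lawL_box_tightN_not_wound_over` — the
  top twin (`h.2 + 3 = n`, `holeN`/`rootN`).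
* ★★★★★ `lawL_box_tightS_im_vertexFunctional_pos` — single removal `S = [h, c]`, `c ∈ {holeS, rootS}`, `2 ≤ h.1`, `h.1 + 4 ≤ m`,
  `h.2 = 2`, `5 ≤ n` ⇒ `Im VF(θ) > 0` on the WHOLE range `[π/3, 2π/3]` (under route EMPTY ⇒ `P₁ ∧ P₃` of LAW L vacuously; over
  witnesses of both kinds fit ⇒ `¬P₂ ∧ ¬P₄`); `lawL_box_tightN_im_vertexFunctional_neg` — the top twin, `Im VF < 0`.
* ★★★★ `thinBox4_near_vertexFunctional_eq_zero` — the height-four thin box (`h.2 = 1`, `n = 4`) with the cell above the hole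
  or above the root plaquette removed ⇒ `VF ≡ 0` (under route empty by the thin side, over route by the dead door above).

With `lawL_box_near_not_killed` (`PlaquetteWalkHoleRootNearCells`: three free rows on the removed cell's side ⇒ nothing is
killed) the four cells at distance one above / below the hole and the root plaquette are classified: such a cell EMPTIES
its own side's route iff the wall behind it is exactly two rows from the hole, and is harmless otherwise (one row: the thin
box, `PlaquetteWalkHoleRootThinBoxCells`; zero rows: `PlaquetteWalkHoleRootWallAdjacent`).

Not in print; venture lane «pcv-sawmu», seat b-step0 gen 28 (FINDING-YB-KILL-FORCED-ZEROS §24; kit j295594/j295595, j291139–43).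

References: A. Glazman, I. Manolescu, arXiv:1708.00395v3, §1 (Fig. 1, Fig. 2, remark after eq. (1)), §2.1, §4.2, Lemma 2.1
[GlazmanManolescu2019]; A. Glazman, Electron. Commun. Probab. 20 (2015) no. 86, Lemma 3.1, proof pp. 6–7
[Glazman2015WeightedSAW]; R. Courant, H. Robbins, *What is Mathematics?* (1941/1958), Ch. V Appendix §2 (the even–odd
rule) [CourantRobbins1958].
-/

noncomputable section

open Set Function Complex

namespace Literature.Barriers.CriticalPhenomena.PlaquetteWalk

open Literature.Probability.RandomPlanarGeometry.SAW.YangBaxter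
open Real Complex

/-! ## Boxes: the tight side of LAW L at distance one -/

section Boxes

variable {m n : ℕ} {S : List Face} {h : Face}

/-- ★★★★★ **ALL BOXES, TIGHT BOTTOM: hole two rows above the bottom wall (`h.2 = 2`) and `holeS = (h.1, 1)` or
`rootS = (h.1 + 1, 1)` removed ⇒ NO WOUND UNDER-WALK** at the far cell of the root plaquette `(h.1 + 1, h.2)`, whatever
else `S ∋ h` removes (far cell kept). The lane's kit datum (j295595: hole `(3,2)` of the frame `[1,5]×[0,4]`, `US2`/`US1`
NONE ≤ 40 arcs with `(3,1)` or `(4,1)` removed; TIMEOUT in every wider frame) as a theorem for all boxes.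
[cite: GlazmanManolescu2019, Lemma 2.1 (statement, "in the form given in [Gl]"), §2.1]
[cite: Glazman2015WeightedSAW, Lemma 3.1 (proof, pp. 6–7)] [cite: CourantRobbins1958, Ch. V Appendix §2 (the even–odd rule)] -/
theorem lawL_box_tightS_not_wound_under (hW : 1 ≤ h.1) (hE : h.1 ≤ m) (hS2 : h.2 = 2) (hN : 3 ≤ n) (hh : h ∈ S)
    (hfS : ((h.1 - 1, h.2) : Face) ∉ S) (hc : ((h.1, 1) : Face) ∈ S ∨ ((h.1 + 1, 1) : Face) ∈ S)
    (ω : ΩG (dom (boxMinus m n S)) (Face.side (h.1 + 1, h.2) .W) (farW (h.1 + 1, h.2))) (hb : ω.IsB2a)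
    (hS : ω.2.firstSideG = .S) (θ : ℝ) :
    ω.WE (fun _ => θ) = excursionWinding θ ω.2.firstSideG
      (ω.z1 (rootedFace_hroot_boxMinus_of_mem (farW_hroot_mem_boxMinus_of_not_mem hW hE (by omega) (by omega) hfS) hh) hb)
      ω.1 := by
  refine ΩG.WE_eq_excursionWinding_of_under_deadDoor_floor ?_ ?_ (fun y hy hm => ?_) ω _ hb hS θ
  · rw [holeFaceW_hroot]; exact not_mem_dom_boxMinus_of_mem hh
  · rcases hc with hd | hd
    · left
      have e : ((((h.1 + 1, h.2) : Face).1 - 1, ((h.1 + 1, h.2) : Face).2 - 1) : Face) = (h.1, 1) :=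
        Prod.ext (by simp only; omega) (by simp only; omega)
      rw [e]; exact not_mem_dom_boxMinus_of_mem hd
    · right
      have e : rootS ((h.1 + 1, h.2) : Face) = (h.1 + 1, 1) := Prod.ext (by simp only [rootS]) (by simp only [rootS]; omega)
      rw [e]; exact not_mem_dom_boxMinus_of_mem hd
  · obtain ⟨hb', -⟩ := mem_dom_boxMinus.1 hm
    simp only at hb' hy
    omega

/-- ★★★★★ **ALL BOXES, TIGHT TOP: hole two rows below the top wall (`h.2 + 3 = n`) and `holeN = (h.1, h.2 + 1)` or
`rootN = (h.1 + 1, h.2 + 1)` removed ⇒ NO WOUND OVER-WALK.** [cite: GlazmanManolescu2019, Lemma 2.1 (statement, "in the form given in [Gl]"), §2.1, §4.2]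
[cite: Glazman2015WeightedSAW, Lemma 3.1 (proof, pp. 6–7)] [cite: CourantRobbins1958, Ch. V Appendix §2 (the even–odd rule)] -/
theorem lawL_box_tightN_not_wound_over (hW : 1 ≤ h.1) (hE : h.1 ≤ m) (hS0 : 0 ≤ h.2) (hN3 : h.2 + 3 = n) (hh : h ∈ S)
    (hfS : ((h.1 - 1, h.2) : Face) ∉ S) (hc : ((h.1, h.2 + 1) : Face) ∈ S ∨ ((h.1 + 1, h.2 + 1) : Face) ∈ S)
    (ω : ΩG (dom (boxMinus m n S)) (Face.side (h.1 + 1, h.2) .W) (farW (h.1 + 1, h.2))) (hb : ω.IsB2a)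
    (hN : ω.2.firstSideG = .N) (θ : ℝ) :
    ω.WE (fun _ => θ) = excursionWinding θ ω.2.firstSideG
      (ω.z1 (rootedFace_hroot_boxMinus_of_mem (farW_hroot_mem_boxMinus_of_not_mem hW hE hS0 (by omega) hfS) hh) hb)
      ω.1 := by
  refine ΩG.WE_eq_excursionWinding_of_over_deadDoor_ceiling ?_ ?_ (fun y hy hm => ?_) ω _ hb hN θ
  · rw [holeFaceW_hroot]; exact not_mem_dom_boxMinus_of_mem hh
  · rcases hc with hd | hd
    · left
      have e : ((((h.1 + 1, h.2) : Face).1 - 1, ((h.1 + 1, h.2) : Face).2 + 1) : Face) = (h.1, h.2 + 1) :=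
        Prod.ext (by simp only; omega) rfl
      rw [e]; exact not_mem_dom_boxMinus_of_mem hd
    · right
      have e : rootN ((h.1 + 1, h.2) : Face) = (h.1 + 1, h.2 + 1) := Prod.ext (by simp only [rootN]) rfl
      rw [e]; exact not_mem_dom_boxMinus_of_mem hd
  · obtain ⟨hb', -⟩ := mem_dom_boxMinus.1 hm
    simp only at hb' hy
    omega

/-- ★★★★★ **TIGHT BOTTOM, SINGLE REMOVAL: `Im VF > 0` ON THE WHOLE RANGE `[π/3, 2π/3]`** — hence `VF ≠ 0` there and, in the
language of LAW L, `P₁ ∧ P₃` (vacuously: the under route is EMPTY) while `P₂`, `P₄` fail. Box `m × n`, hole `h = (h.1, 2)`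
with `2 ≤ h.1`, `h.1 + 4 ≤ m`, `5 ≤ n`, and `c ∈ {holeS = (h.1, 1), rootS = (h.1 + 1, 1)}` removed: the over witnesses
`nearBlockSO2` (`[1,5]×[0,4]`, `PlaquetteWalkHoleRootNearCells`) and `ringBlockON1a` (`[1,6]×[0,4]`,
`PlaquetteWalkHoleRootInteriorRing`) avoid `c` and fit. [cite: GlazmanManolescu2019, Lemma 2.1 (statement, "in the form given in [Gl]"), §1 eq. (1), §2.1]
[cite: Glazman2015WeightedSAW, Lemma 3.1 (proof, pp. 6–7)] [cite: CourantRobbins1958, Ch. V Appendix §2 (the even–odd rule)] -/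
theorem lawL_box_tightS_im_vertexFunctional_pos (hW : 2 ≤ h.1) (hE : h.1 + 4 ≤ m) (hS2 : h.2 = 2) (hN : 5 ≤ n) {x : ℤ}
    (hx : x = h.1 ∨ x = h.1 + 1) {θ : ℝ} (hθ : θ ∈ Set.Icc (π / 3) (2 * π / 3)) :
    0 < (vertexFunctional (printedWeights θ) tFiveEighths (ybCoeff θ) (boxMinus m n [h, (x, 1)]) (Face.side (h.1 + 1, h.2) .W)
      (farW (h.1 + 1, h.2))).im := by
  have sub := block_hroot_subset_boxMinus_of_bounds (m := m) (n := n) (h := h)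
  have hh : h ∈ [h, (x, 1)] := by simp
  have hfS : ((h.1 - 1, h.2) : Face) ∉ [h, (x, 1)] := by
    rw [List.mem_cons, List.mem_singleton, not_or]
    exact ⟨fun e => by have := (Prod.ext_iff.1 e).1; simp only at this; omega,
      fun e => by have := (Prod.ext_iff.1 e).1; simp only at this; omega⟩
  have hf := farW_hroot_mem_boxMinus_of_not_mem (m := m) (n := n) (by omega) (by omega) (by omega) (by omega) hfS
  have hr := rootedFace_hroot_boxMinus_of_mem hf hh
  have hhD : holeFaceW ((h.1 + 1, h.2) : Face) ∉ dom (boxMinus m n [h, (x, 1)]) := by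
    rw [holeFaceW_hroot]; exact not_mem_dom_boxMinus_of_mem hh
  have hdoor : ((((h.1 + 1, h.2) : Face).1 - 1, ((h.1 + 1, h.2) : Face).2 - 1) : Face) ∉ dom (boxMinus m n [h, (x, 1)]) ∨
      rootS ((h.1 + 1, h.2) : Face) ∉ dom (boxMinus m n [h, (x, 1)]) := by
    rcases hx with rfl | rfl
    · left
      have e : ((((h.1 + 1, h.2) : Face).1 - 1, ((h.1 + 1, h.2) : Face).2 - 1) : Face) = (h.1, 1) :=
        Prod.ext (by simp only; omega) (by simp only; omega)
      rw [e]; exact not_mem_dom_boxMinus_of_mem (by simp)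
    · right
      have e : rootS ((h.1 + 1, h.2) : Face) = (h.1 + 1, 1) := Prod.ext (by simp only [rootS]) (by simp only [rootS]; omega)
      rw [e]; exact not_mem_dom_boxMinus_of_mem (by simp)
  have hfloor : ∀ y : ℤ, y ≤ ((h.1 + 1, h.2) : Face).2 - 3 → ((((h.1 + 1, h.2) : Face).1 - 1, y) : Face) ∉
      dom (boxMinus m n [h, (x, 1)]) := by
    intro y hy hm
    obtain ⟨hb', -⟩ := mem_dom_boxMinus.1 hm
    simp only at hb' hy
    omega
  rcases hx with rfl | rfl
  · exact im_vertexFunctional_printed_pos_of_deadDoor_floor hθ hf hhD hdoor hfloor hr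
      (exists_over_W2FreeOff_of_nearBlockSO2 (sub nearBlockSO242 1 5 0 4 3 1 (by decide) (by omega) (by omega)
        (by omega) (by omega) ⟨by omega, by omega⟩) hr)
      (exists_over_W1FreeOff_of_ringBlockON1a (sub ringBlockON1a42 1 6 0 4 3 1 (by decide) (by omega) (by omega)
        (by omega) (by omega) ⟨by omega, by omega⟩) hr)
  · exact im_vertexFunctional_printed_pos_of_deadDoor_floor hθ hf hhD hdoor hfloor hr
      (exists_over_W2FreeOff_of_nearBlockSO2 (sub nearBlockSO242 1 5 0 4 4 1 (by decide) (by omega) (by omega)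
        (by omega) (by omega) ⟨by omega, by omega⟩) hr)
      (exists_over_W1FreeOff_of_ringBlockON1a (sub ringBlockON1a42 1 6 0 4 4 1 (by decide) (by omega) (by omega)
        (by omega) (by omega) ⟨by omega, by omega⟩) hr)

/-- ★★★★★ **TIGHT TOP, SINGLE REMOVAL: `Im VF < 0` ON THE WHOLE RANGE** (`h.2 + 3 = n`, `2 ≤ h.1`, `h.1 + 4 ≤ m`, `2 ≤ h.2`,
`c ∈ {holeN, rootN}` removed; the under witnesses `ringBlockUS2a`, `nearBlockNU1` avoid `c` and fit): the over route is EMPTY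
(`P₂ ∧ P₄` vacuously), the under route alive at every angle. [cite: GlazmanManolescu2019, Lemma 2.1 (statement, "in the form given in [Gl]"), §1 eq. (1), §2.1]
[cite: Glazman2015WeightedSAW, Lemma 3.1 (proof, pp. 6–7)] [cite: CourantRobbins1958, Ch. V Appendix §2 (the even–odd rule)] -/
theorem lawL_box_tightN_im_vertexFunctional_neg (hW : 2 ≤ h.1) (hE : h.1 + 4 ≤ m) (hS : 2 ≤ h.2) (hN3 : h.2 + 3 = n) {x : ℤ}
    (hx : x = h.1 ∨ x = h.1 + 1) {θ : ℝ} (hθ : θ ∈ Set.Icc (π / 3) (2 * π / 3)) :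
    (vertexFunctional (printedWeights θ) tFiveEighths (ybCoeff θ) (boxMinus m n [h, (x, h.2 + 1)]) (Face.side (h.1 + 1, h.2) .W)
      (farW (h.1 + 1, h.2))).im < 0 := by
  have sub := block_hroot_subset_boxMinus_of_bounds (m := m) (n := n) (h := h)
  have hh : h ∈ [h, (x, h.2 + 1)] := by simp
  have hfS : ((h.1 - 1, h.2) : Face) ∉ [h, (x, h.2 + 1)] := by
    rw [List.mem_cons, List.mem_singleton, not_or]
    exact ⟨fun e => by have := (Prod.ext_iff.1 e).1; simp only at this; omega,
      fun e => by have := (Prod.ext_iff.1 e).1; simp only at this; omega⟩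
  have hf := farW_hroot_mem_boxMinus_of_not_mem (m := m) (n := n) (by omega) (by omega) (by omega) (by omega) hfS
  have hr := rootedFace_hroot_boxMinus_of_mem hf hh
  have hhD : holeFaceW ((h.1 + 1, h.2) : Face) ∉ dom (boxMinus m n [h, (x, h.2 + 1)]) := by
    rw [holeFaceW_hroot]; exact not_mem_dom_boxMinus_of_mem hh
  have hdoor : ((((h.1 + 1, h.2) : Face).1 - 1, ((h.1 + 1, h.2) : Face).2 + 1) : Face) ∉ dom (boxMinus m n [h, (x, h.2 + 1)]) ∨
      rootN ((h.1 + 1, h.2) : Face) ∉ dom (boxMinus m n [h, (x, h.2 + 1)]) := by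
    rcases hx with rfl | rfl
    · left
      have e : ((((h.1 + 1, h.2) : Face).1 - 1, ((h.1 + 1, h.2) : Face).2 + 1) : Face) = (h.1, h.2 + 1) :=
        Prod.ext (by simp only; omega) rfl
      rw [e]; exact not_mem_dom_boxMinus_of_mem (by simp)
    · right
      have e : rootN ((h.1 + 1, h.2) : Face) = (h.1 + 1, h.2 + 1) := Prod.ext (by simp only [rootN]) rfl
      rw [e]; exact not_mem_dom_boxMinus_of_mem (by simp)
  have hceil : ∀ y : ℤ, ((h.1 + 1, h.2) : Face).2 + 3 ≤ y → ((((h.1 + 1, h.2) : Face).1 - 1, y) : Face) ∉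
      dom (boxMinus m n [h, (x, h.2 + 1)]) := by
    intro y hy hm
    obtain ⟨hb', -⟩ := mem_dom_boxMinus.1 hm
    simp only at hb' hy
    omega
  rcases hx with rfl | rfl
  · exact im_vertexFunctional_printed_neg_of_deadDoor_ceiling hθ hf hhD hdoor hceil hr
      (exists_under_W2FreeOff_of_ringBlockUS2a (sub ringBlockUS2a42 1 6 0 4 3 3 (by decide) (by omega) (by omega)
        (by omega) (by omega) ⟨by omega, by omega⟩) hr)
      (exists_under_W1FreeOff_of_nearBlockNU1 (sub nearBlockNU142 1 5 0 4 3 3 (by decide) (by omega) (by omega)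
        (by omega) (by omega) ⟨by omega, by omega⟩) hr)
  · exact im_vertexFunctional_printed_neg_of_deadDoor_ceiling hθ hf hhD hdoor hceil hr
      (exists_under_W2FreeOff_of_ringBlockUS2a (sub ringBlockUS2a42 1 6 0 4 4 3 (by decide) (by omega) (by omega)
        (by omega) (by omega) ⟨by omega, by omega⟩) hr)
      (exists_under_W1FreeOff_of_nearBlockNU1 (sub nearBlockNU142 1 5 0 4 4 3 (by decide) (by omega) (by omega)
        (by omega) (by omega) ⟨by omega, by omega⟩) hr)

/-- ★★★★ **THE HEIGHT-FOUR THIN BOX WITH `holeN` OR `rootN` REMOVED: `VF ≡ 0`.** Hole `(h.1, 1)` one row above the bottom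
wall of an `m × 4` box (`1 ≤ h.1 ≤ m`), the cell `(x, 2)` above the hole (`x = h.1`) or above the root plaquette
(`x = h.1 + 1`) removed: the under route is empty by the thin side (`PlaquetteWalkHoleRootThinSide`: `K_S2 = (h.1 − 2, −1)`,
the cell below `farSW` and the row below the box are outside), the over route by the dead door `holeN | rootN` with the top
wall two rows above the hole (rows `2, 3`; §3) — both route masses vanish. (The lane's kit datum j291139–43: `ON2`/`ON1`
NONE ≤ 36 arcs in the height-four frames with `(3,3)` or `(4,3)` removed; `PlaquetteWalkHoleRootThinBoxCells` typed the
other top-row cells.) [cite: GlazmanManolescu2019, Lemma 2.1 (statement, "in the form given in [Gl]"), §2.1]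
[cite: Glazman2015WeightedSAW, Lemma 3.1 (proof, pp. 6–7)] [cite: CourantRobbins1958, Ch. V Appendix §2 (the even–odd rule)] -/
theorem thinBox4_near_vertexFunctional_eq_zero (hW : 1 ≤ h.1) (hE : h.1 ≤ m) (hS1 : h.2 = 1) (hn : n = 4) {x : ℤ}
    (hx : x = h.1 ∨ x = h.1 + 1) {θ : ℝ} (hθ : θ ∈ Set.Icc (π / 3) (2 * π / 3)) :
    vertexFunctional (printedWeights θ) tFiveEighths (ybCoeff θ) (boxMinus m n [h, (x, 2)]) (Face.side (h.1 + 1, h.2) .W)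
      (farW (h.1 + 1, h.2)) = 0 := by
  have hh : h ∈ [h, (x, 2)] := by simp
  have hfS : ((h.1 - 1, h.2) : Face) ∉ [h, (x, 2)] := by
    rw [List.mem_cons, List.mem_singleton, not_or]
    exact ⟨fun e => by have := (Prod.ext_iff.1 e).1; simp only at this; omega,
      fun e => by have := (Prod.ext_iff.1 e).2; simp only at this; omega⟩
  have hf := farW_hroot_mem_boxMinus_of_not_mem (m := m) (n := n) (by omega) (by omega) (by omega) (by omega) hfS
  have hr := rootedFace_hroot_boxMinus_of_mem hf hh
  have hhD : holeFaceW ((h.1 + 1, h.2) : Face) ∉ dom (boxMinus m n [h, (x, 2)]) := by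
    rw [holeFaceW_hroot]; exact not_mem_dom_boxMinus_of_mem hh
  have hdoor : ((((h.1 + 1, h.2) : Face).1 - 1, ((h.1 + 1, h.2) : Face).2 + 1) : Face) ∉ dom (boxMinus m n [h, (x, 2)]) ∨
      rootN ((h.1 + 1, h.2) : Face) ∉ dom (boxMinus m n [h, (x, 2)]) := by
    rcases hx with rfl | rfl
    · left
      have e : ((((h.1 + 1, h.2) : Face).1 - 1, ((h.1 + 1, h.2) : Face).2 + 1) : Face) = (h.1, 2) :=
        Prod.ext (by simp only; omega) (by simp only; omega)
      rw [e]; exact not_mem_dom_boxMinus_of_mem (by simp)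
    · right
      have e : rootN ((h.1 + 1, h.2) : Face) = (h.1 + 1, 2) := Prod.ext (by simp only [rootN]) (by simp only [rootN]; omega)
      rw [e]; exact not_mem_dom_boxMinus_of_mem (by simp)
  have hceil : ∀ y : ℤ, ((h.1 + 1, h.2) : Face).2 + 3 ≤ y → ((((h.1 + 1, h.2) : Face).1 - 1, y) : Face) ∉
      dom (boxMinus m n [h, (x, 2)]) := by
    intro y hy hm
    obtain ⟨hb', -⟩ := mem_dom_boxMinus.1 hm
    simp only at hb' hy
    omega
  -- the under route: thin side (`K_S2`, the cell below `farSW` and the whole row below are outside the box)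
  have hKS : killSW ((h.1 + 1, h.2) : Face) ∉ dom (boxMinus m n [h, (x, 2)]) := by
    intro hm; obtain ⟨hb', -⟩ := mem_dom_boxMinus.1 hm; simp only [killSW] at hb'; omega
  have hT : ((((h.1 + 1, h.2) : Face).1 - 2, ((h.1 + 1, h.2) : Face).2 - 2) : Face) ∉ dom (boxMinus m n [h, (x, 2)]) := by
    intro hm; obtain ⟨hb', -⟩ := mem_dom_boxMinus.1 hm; simp only at hb'; omega
  have hcolS : ∀ y : ℤ, y ≤ ((h.1 + 1, h.2) : Face).2 - 3 →
      ((((h.1 + 1, h.2) : Face).1 - 3, y) : Face) ∉ dom (boxMinus m n [h, (x, 2)]) ∨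
        ((((h.1 + 1, h.2) : Face).1 - 2, y) : Face) ∉ dom (boxMinus m n [h, (x, 2)]) := by
    intro y hy; left; intro hm; obtain ⟨hb', -⟩ := mem_dom_boxMinus.1 hm; simp only at hb' hy; omega
  rw [vertexFunctional_printed_farCellW_eq hθ _ _ hf hhD hr,
    ΩG.sum_routeMassW_S_eq_zero_of_thinS hhD hKS hcolS hT hr θ,
    ΩG.sum_routeMassW_N_eq_zero_of_deadDoor_ceiling hhD hdoor hceil hr θ]
  simp

end Boxes

end Literature.Barriers.CriticalPhenomena.PlaquetteWalk
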